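import Summits.BirchSwinnertonDyer.BirchSwinnertonDyer.Theorems.SchneiderFreeAdditiveX3LocalTowerTorsionFiniteOfLine
import Summits.BirchSwinnertonDyer.BirchSwinnertonDyer.Theorems.SchneiderFreeAdditiveX3LocalTowerTorsionLineClauses
import Summits.BirchSwinnertonDyer.Rank1Residual.Additive.GordRamifiedOrdinaryLine
import Summits.BirchSwinnertonDyer.Rank1Residual.Additive.X3SharpResidue
import Literature.NumberTheory.GaloisRepresentations.KummerQuadraticCharacterInertia
import HarnessLib

/-!
# FILE 2 of the (G-ord, `e = 2`) line-with-character plan: the ramified quadratic TWIST transport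
# WITH CHARACTER (crux `LocalTowerTorsionFiniteX3`, stmt-BirchSwinnertonDyer-19546)

Seat `bsd-schneider-door-c5` (cell `bsd-schneider-ideate`), gen 6; route `SchneiderFreeAdditiveX3`,
crux r5 `LocalTowerTorsionFiniteX3` (Fin_v). Hypothesis (ii) «the canonical line WITH its character»
of gen 5's `stub_finV_gordTwo_of_lineCharacter` (p446206) on the (G-ord, `e = 2`) cell factors
(door-c6 g3, STATUS 13:35Z) as FILE 1 (unit-root Frobenius character of Greenberg's reduction line
`C_v(V)` of the good-ordinary `p*`-twist model `V`, UNTWISTED: inertia trivial on `V[p^∞]/C_v`, every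
`σ` of Frobenius degree `n` acting on `C_v[p^k]` by `χ_p(σ)·α^{−n}`), FILE 2 (this file: transport
along the twisting isomorphism `e : V[p^∞] ≃ W[p^∞]`, `e(σm) = ψ_d(σ)·σe(m)`, `W ≅ V ⊗ ψ_d`, `ψ_d`
the quadratic character of `√d`, RAMIFIED at the place) and FILE 3 (door-c4 g5: `(ℚ̄, D_v) → (K̄, D_𝔭)`).

* §1 `lineCharacter_twist_of_lineCharacter` (any number field `K`, place `v`, odd `p`): an UNTWISTED
  line-with-character `(C, a, α)` on `V[p^∞]` (`D_v`-stable, `#C[p] ≤ p`, all orders, inertia trivial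
  modulo `C`, character `χ_p·α^{−n}`), a sign-equivariant `e` anti-equivariant at some `τ₀` of the
  local inertia group, yield on `W[p^∞]` the ∃-body of door-c5's `hLine` VERBATIM: `e(C)` is
  `D_v`-stable with the same numeric clauses, `res τ₀` acts as `−1` modulo `e(C)`, and `σ` of
  Frobenius degree `n` acts on `e(C)[p^k]` by `s(σ)·χ_p(σ)·α^{−n}`, `s(σ) = ±1` the sign of `e` at
  `res σ`.
* §2 `lineCharacter_twist_rat` — over `ℚ` at `v ∋ p` with `ord_v d = 1` the anti-equivariant
  inertia element is the tree's Kummer element (`Additive.exists_mem_absInertia_smul_geomSqrt_eq_neg`,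
  FILE B §2); `lineCharacter_model_twist_rat` — the same for a `ℚ`-model `W = C • V^{(d)}` (the
  twisting isomorphism from FILE A `exists_addEquiv_geomPrimaryTorsion_of_model_twist_sign`).

Pure Galois-module algebra; proofs only (no definition, no named fact, no `sorry`); `--supports`
stmt-BirchSwinnertonDyer-19546; closes nothing by itself; BSD is not advanced.
References: [EmertonPollackWeston2006] §3.1 (eq:ordes) (arXiv:math/0404484 p. 17); [GreenbergLNM1716]
§2 pp. 62–63, 69–70; [SilvermanAEC2009] X.5 Cor. 5.4; [Lang1983] Ch. 6 Prop. 1.3; [JetchevSkinnerWan2017]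
§3.3 Prop. 3.3.4 Case 3(b).
-/

noncomputable section

open scoped Classical

namespace Summit.BirchSwinnertonDyer.BirchSwinnertonDyer.Theorems.SchneiderFreeAdditiveX3

open NumberField IsDedekindDomain Field WeierstrassCurve
  Literature.NumberTheory.EllipticCurves Literature.NumberTheory.EllipticCurves.GreenbergSelmer
  Literature.NumberTheory.GaloisRepresentations
  IsDedekindDomain.HeightOneSpectrum

set_option linter.dupNamespace false

/-! ## §1. Transport of an untwisted line-with-character along a sign-equivariant isomorphism -/

section Transport

variable {K : Type} [Field K] [NumberField K] {V W : WeierstrassCurve K} {p : ℕ} [hp : Fact p.Prime]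
  {v : HeightOneSpectrum (𝓞 K)}

/-- **The quadratic-twist transport WITH CHARACTER.** `K` a number field, `v` a finite place, `p` a
prime; `e : V[p^∞] ≃+ W[p^∞]` additive and SIGN-equivariant at every `σ ∈ Γ_K` (the twisting
isomorphism of `W ≅ V ⊗ ψ`), ANTI-equivariant at `res τ₀` for some `τ₀` in the local inertia group at
`v` (`ψ` ramified); `C ≤ V[p^∞]` a `D_v`-stable subgroup with `#C[p] ≤ p`, points of every order
`p^k`, inertia acting TRIVIALLY on `V[p^∞]/C`, and every `σ ∈ Γ_{K_v}` of Frobenius degree `n` acting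
on `C[p^k]` by `χ_p(res σ)·α^{−n}` (`α² = aα − p`; Greenberg LNM 1716 §2 p. 70: the ordinary line
`ℱ[p^∞]` carries `χ_p·φ⁻¹`, `φ` unramified with `φ(Frob) = α`). Then `e(C) ≤ W[p^∞]` is `D_v`-stable
with the same numeric clauses, `res τ₀` acts as `−1` modulo `e(C)`, and every `σ` of Frobenius
degree `n` acts on `e(C)[p^k]` by `s·χ_p(res σ)·α^{−n}` with `s = ±1` the sign of `e` at `res σ` —
the ∃-body of hypothesis (ii) of `stub_finV_gordTwo_of_lineCharacter`, at `(K, v)`.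
[cite: EmertonPollackWeston2006, §3.1 (eq:ordes) (arXiv:math/0404484 p. 17)]
[cite: GreenbergLNM1716, §2 pp. 69–70] [cite: SilvermanAEC2009, X.5 Cor. 5.4] -/
theorem lineCharacter_twist_of_lineCharacter
    (e : ↥(V.geomPrimaryTorsion p) ≃+ ↥(W.geomPrimaryTorsion p))
    (he : ∀ σ : absoluteGaloisGroup K, (∀ m, e (σ • m) = σ • e m) ∨ (∀ m, e (σ • m) = -(σ • e m)))
    {τ₀ : absoluteGaloisGroup (v.adicCompletion K)} (hτ₀ : τ₀ ∈ absInertia (v.adicCompletion K))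
    (hτ₀neg : ∀ m, e (absGaloisRestrict K (v.adicCompletion K) τ₀ • m) =
      -(absGaloisRestrict K (v.adicCompletion K) τ₀ • e m))
    (C : AddSubgroup (V.geomPrimaryTorsion p))
    (hCD : ∀ d ∈ decomp v, ∀ c ∈ C, d • c ∈ C)
    (hC1 : Set.ncard {c : V.geomPrimaryTorsion p | c ∈ C ∧ p • c = 0} ≤ p)
    (hCord : ∀ k : ℕ, ∃ c ∈ C, addOrderOf c = p ^ k)
    (htriv : ∀ x ∈ inertia v, ∀ m : V.geomPrimaryTorsion p, x • m - m ∈ C)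
    (a : ℤ) (α : ℤ_[p]ˣ) (hα : ((α : ℤ_[p])) ^ 2 = a * (α : ℤ_[p]) - p)
    (hchar : ∀ (σ : absoluteGaloisGroup (v.adicCompletion K)) (n : ℕ), IsFrobPow σ (n : ℤ) →
      ∀ (k : ℕ) (c : V.geomPrimaryTorsion p), c ∈ C → p ^ k • c = 0 →
        ∀ N : ℤ, ((N : ℤ_[p]) -
            ((GaloisRep.cyclotomicCharacter K p (absGaloisRestrict K (v.adicCompletion K) σ) *
              (α⁻¹) ^ n : ℤ_[p]ˣ) : ℤ_[p]) ∈ (Ideal.span {(p : ℤ_[p]) ^ k} : Ideal ℤ_[p])) →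
          absGaloisRestrict K (v.adicCompletion K) σ • c = N • c) :
    ∃ (C' : AddSubgroup (W.geomPrimaryTorsion p)) (a' : ℤ) (α' : ℤ_[p]ˣ),
      (∀ d ∈ decomp v, ∀ c ∈ C', d • c ∈ C') ∧
      Set.ncard {c : W.geomPrimaryTorsion p | c ∈ C' ∧ p • c = 0} ≤ p ∧
      (∀ k : ℕ, ∃ c ∈ C', addOrderOf c = p ^ k) ∧
      (∃ τ ∈ decomp v, ∀ m : W.geomPrimaryTorsion p, τ • m + m ∈ C') ∧
      ((α' : ℤ_[p])) ^ 2 = a' * (α' : ℤ_[p]) - p ∧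
      (∀ (σ : absoluteGaloisGroup (v.adicCompletion K)) (n : ℕ), IsFrobPow σ (n : ℤ) →
        ∃ s : ℤ, (s = 1 ∨ s = -1) ∧
          ∀ (k : ℕ) (c : W.geomPrimaryTorsion p), c ∈ C' → p ^ k • c = 0 →
            ∀ N : ℤ, ((N : ℤ_[p]) - s *
                ((GaloisRep.cyclotomicCharacter K p (absGaloisRestrict K (v.adicCompletion K) σ) *
                  (α'⁻¹) ^ n : ℤ_[p]ˣ) : ℤ_[p]) ∈ (Ideal.span {(p : ℤ_[p]) ^ k} : Ideal ℤ_[p])) →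
              absGaloisRestrict K (v.adicCompletion K) σ • c = N • c) := by
  set F := v.adicCompletion K with hF
  -- the transported subgroup `C' = e(C)`
  set C' : AddSubgroup (W.geomPrimaryTorsion p) := C.map e.toAddMonoidHom with hC'
  have hmem : ∀ m : W.geomPrimaryTorsion p, m ∈ C' ↔ e.symm m ∈ C := by
    intro m
    rw [hC', AddSubgroup.mem_map]
    constructor
    · rintro ⟨c, hc, rfl⟩
      change e.symm (e c) ∈ C
      rwa [e.symm_apply_apply]
    · intro h
      exact ⟨e.symm m, h, e.apply_symm_apply m⟩
  have hmem' : ∀ c : V.geomPrimaryTorsion p, e c ∈ C' ↔ c ∈ C := fun c ↦ by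
    rw [hmem, e.symm_apply_apply]
  refine ⟨C', a, α, ?_, ?_, ?_, ?_, hα, ?_⟩
  · -- `D_v`-stability: `e⁻¹(δ • e c) = ± δ • c`
    intro δ hδ m hm
    obtain ⟨c, rfl⟩ : ∃ c, e c = m := ⟨e.symm m, e.apply_symm_apply m⟩
    have hc : c ∈ C := (hmem' c).1 hm
    rcases he δ with h | h
    · rw [← h c, hmem']; exact hCD δ hδ c hc
    · have : δ • e c = -(e (δ • c)) := by rw [h c, neg_neg]
      rw [this, neg_mem_iff, hmem']; exact hCD δ hδ c hc
  · -- `#C'[p] ≤ p`: `e` is a bijection `C[p] ≃ C'[p]`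
    have heq : {c : W.geomPrimaryTorsion p | c ∈ C' ∧ p • c = 0} =
        e '' {c : V.geomPrimaryTorsion p | c ∈ C ∧ p • c = 0} := by
      ext m
      constructor
      · rintro ⟨hm, hpm⟩
        refine ⟨e.symm m, ⟨(hmem m).1 hm, ?_⟩, e.apply_symm_apply m⟩
        apply e.injective
        rw [map_nsmul, e.apply_symm_apply, hpm, map_zero]
      · rintro ⟨c, ⟨hc, hpc⟩, rfl⟩
        exact ⟨(hmem' c).2 hc, by rw [← map_nsmul, hpc, map_zero]⟩
    rw [heq, Set.ncard_image_of_injective _ e.injective]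
    exact hC1
  · -- points of every order
    intro k
    obtain ⟨c, hc, hord⟩ := hCord k
    exact ⟨e c, (hmem' c).2 hc, by rw [← hord]; exact AddEquiv.addOrderOf_eq e c⟩
  · -- `res τ₀` acts as `−1` modulo `C'`
    refine ⟨absGaloisRestrict K F τ₀, ⟨τ₀, rfl⟩, fun m ↦ ?_⟩
    obtain ⟨c, rfl⟩ : ∃ c, e c = m := ⟨e.symm m, e.apply_symm_apply m⟩
    have hx : absGaloisRestrict K F τ₀ ∈ inertia v := Subgroup.mem_map.2 ⟨τ₀, hτ₀, rfl⟩
    have hrw : absGaloisRestrict K F τ₀ • e c + e c = -(e (absGaloisRestrict K F τ₀ • c - c)) := by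
      rw [map_sub, hτ₀neg c]; abel
    rw [hrw, neg_mem_iff, hmem']
    exact htriv _ hx c
  · -- the character, with the sign of `e` at `res σ`
    intro σ n hσn
    set g := absGaloisRestrict K F σ with hg
    rcases he g with hpos | hneg
    · refine ⟨1, Or.inl rfl, fun k m hm hpm N hN ↦ ?_⟩
      obtain ⟨c, rfl⟩ : ∃ c, e c = m := ⟨e.symm m, e.apply_symm_apply m⟩
      have hc : c ∈ C := (hmem' c).1 hm
      have hpc : p ^ k • c = 0 := e.injective (by rw [map_nsmul, hpm, map_zero])
      rw [Int.cast_one, one_mul] at hN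
      have h := hchar σ n hσn k c hc hpc N hN
      rw [← hg] at h
      rw [← hpos c, h, map_zsmul]
    · refine ⟨-1, Or.inr rfl, fun k m hm hpm N hN ↦ ?_⟩
      obtain ⟨c, rfl⟩ : ∃ c, e c = m := ⟨e.symm m, e.apply_symm_apply m⟩
      have hc : c ∈ C := (hmem' c).1 hm
      have hpc : p ^ k • c = 0 := e.injective (by rw [map_nsmul, hpm, map_zero])
      -- `-N ≡ χ α^{-n}`, so `res σ • c = (-N) • c` and `res σ • e c = -e(res σ • c) = N • e c`
      have hN' : (((-N : ℤ) : ℤ_[p]) -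
          ((GaloisRep.cyclotomicCharacter K p g * (α⁻¹) ^ n : ℤ_[p]ˣ) : ℤ_[p])) ∈
          (Ideal.span {(p : ℤ_[p]) ^ k} : Ideal ℤ_[p]) := by
        have : (((-N : ℤ) : ℤ_[p]) -
            ((GaloisRep.cyclotomicCharacter K p g * (α⁻¹) ^ n : ℤ_[p]ˣ) : ℤ_[p])) =
            -(((N : ℤ_[p]) - (-1 : ℤ) *
              ((GaloisRep.cyclotomicCharacter K p g * (α⁻¹) ^ n : ℤ_[p]ˣ) : ℤ_[p]))) := by
          push_cast; ring
        rw [this]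
        exact Submodule.neg_mem _ hN
      have h := hchar σ n hσn k c hc hpc (-N) hN'
      rw [← hg] at h
      have hneg' : g • e c = -(e (g • c)) := by rw [hneg c, neg_neg]
      rw [hneg', h, map_zsmul, neg_zsmul, neg_neg]

end Transport

/-! ## §2. Over `ℚ` at `v ∋ p`: the Kummer inertia element of a ramified twist (`ord_v d = 1`) -/

section Rat

variable {V W : WeierstrassCurve ℚ} {p : ℕ} [hp : Fact p.Prime] {v : HeightOneSpectrum (𝓞 ℚ)}

/-- **FILE 2 over `ℚ`.** `p` odd, `v ∋ p`, `d ∈ ℤ` with `ord_v d = 1`, `e : V[p^∞] ≃+ W[p^∞]`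
sign-equivariant and ANTI-equivariant wherever `σ√d = −√d` (the twisting isomorphism of
`W ≅ V ⊗ ψ_d`); an UNTWISTED line-with-character `(C, a, α)` on `V[p^∞]` at `v` (FILE 1's output for
Greenberg's reduction line of the good-ordinary model). Then `e(C)` with `(a, α)` is a line WITH
character on `W[p^∞]` at `(ℚ, v)` in the shape of hypothesis (ii) of
`stub_finV_gordTwo_of_lineCharacter` (FILE 3's input): the `−1` element is the Kummer inertia element
`σ√d = −√d` (`Additive.exists_mem_absInertia_smul_geomSqrt_eq_neg`).
[cite: EmertonPollackWeston2006, §3.1 (eq:ordes) (arXiv:math/0404484 p. 17)]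
[cite: Lang1983, Ch. 6 Prop. 1.3] [cite: SilvermanAEC2009, X.5 Cor. 5.4] -/
theorem lineCharacter_twist_rat (hp2 : p ≠ 2) (hpv : ((p : ℕ) : 𝓞 ℚ) ∈ v.asIdeal)
    {d : ℤ} (hd : v.intValuation (d : 𝓞 ℚ) = WithZero.exp (-1 : ℤ))
    (e : ↥(V.geomPrimaryTorsion p) ≃+ ↥(W.geomPrimaryTorsion p))
    (he : ∀ σ : absoluteGaloisGroup ℚ, (∀ m, e (σ • m) = σ • e m) ∨ (∀ m, e (σ • m) = -(σ • e m)))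
    (heneg : ∀ σ : absoluteGaloisGroup ℚ, σ • geomSqrt (d : ℚ) = -geomSqrt (d : ℚ) →
      ∀ m, e (σ • m) = -(σ • e m))
    (C : AddSubgroup (V.geomPrimaryTorsion p))
    (hCD : ∀ δ ∈ decomp v, ∀ c ∈ C, δ • c ∈ C)
    (hC1 : Set.ncard {c : V.geomPrimaryTorsion p | c ∈ C ∧ p • c = 0} ≤ p)
    (hCord : ∀ k : ℕ, ∃ c ∈ C, addOrderOf c = p ^ k)
    (htriv : ∀ x ∈ inertia v, ∀ m : V.geomPrimaryTorsion p, x • m - m ∈ C)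
    (a : ℤ) (α : ℤ_[p]ˣ) (hα : ((α : ℤ_[p])) ^ 2 = a * (α : ℤ_[p]) - p)
    (hchar : ∀ (σ : absoluteGaloisGroup (v.adicCompletion ℚ)) (n : ℕ), IsFrobPow σ (n : ℤ) →
      ∀ (k : ℕ) (c : V.geomPrimaryTorsion p), c ∈ C → p ^ k • c = 0 →
        ∀ N : ℤ, ((N : ℤ_[p]) -
            ((GaloisRep.cyclotomicCharacter ℚ p (absGaloisRestrict ℚ (v.adicCompletion ℚ) σ) *
              (α⁻¹) ^ n : ℤ_[p]ˣ) : ℤ_[p]) ∈ (Ideal.span {(p : ℤ_[p]) ^ k} : Ideal ℤ_[p])) →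
          absGaloisRestrict ℚ (v.adicCompletion ℚ) σ • c = N • c) :
    ∃ (C' : AddSubgroup (W.geomPrimaryTorsion p)) (a' : ℤ) (α' : ℤ_[p]ˣ),
      (∀ δ ∈ decomp v, ∀ c ∈ C', δ • c ∈ C') ∧
      Set.ncard {c : W.geomPrimaryTorsion p | c ∈ C' ∧ p • c = 0} ≤ p ∧
      (∀ k : ℕ, ∃ c ∈ C', addOrderOf c = p ^ k) ∧
      (∃ τ ∈ decomp v, ∀ m : W.geomPrimaryTorsion p, τ • m + m ∈ C') ∧
      ((α' : ℤ_[p])) ^ 2 = a' * (α' : ℤ_[p]) - p ∧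
      (∀ (σ : absoluteGaloisGroup (v.adicCompletion ℚ)) (n : ℕ), IsFrobPow σ (n : ℤ) →
        ∃ s : ℤ, (s = 1 ∨ s = -1) ∧
          ∀ (k : ℕ) (c : W.geomPrimaryTorsion p), c ∈ C' → p ^ k • c = 0 →
            ∀ N : ℤ, ((N : ℤ_[p]) - s *
                ((GaloisRep.cyclotomicCharacter ℚ p (absGaloisRestrict ℚ (v.adicCompletion ℚ) σ) *
                  (α'⁻¹) ^ n : ℤ_[p]ˣ) : ℤ_[p]) ∈ (Ideal.span {(p : ℤ_[p]) ^ k} : Ideal ℤ_[p])) →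
              absGaloisRestrict ℚ (v.adicCompletion ℚ) σ • c = N • c) := by
  obtain ⟨τ₀, hτ₀, hτ₀neg⟩ :=
    Summit.BirchSwinnertonDyer.Rank1Residual.Additive.exists_mem_absInertia_smul_geomSqrt_eq_neg p
      hp2 hpv hd
  exact lineCharacter_twist_of_lineCharacter e he hτ₀ (heneg _ hτ₀neg) C hCD hC1 hCord htriv a α
    hα hchar

/-- **FILE 2 for a `ℚ`-model `W = C • V^{(d)}`** (`ord_v d = 1`, e.g. `d = p*` for the (G-ord,
`e = 2`) cell's good-ordinary twist model): the twisting isomorphism is FILE A's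
`exists_addEquiv_geomPrimaryTorsion_of_model_twist_sign`. [cite: SilvermanAEC2009, X.5 Cor. 5.4]
[cite: EmertonPollackWeston2006, §3.1 (eq:ordes) (arXiv:math/0404484 p. 17)] -/
theorem lineCharacter_model_twist_rat (hp2 : p ≠ 2) (hpv : ((p : ℕ) : 𝓞 ℚ) ∈ v.asIdeal)
    {d : ℤ} (hd : v.intValuation (d : 𝓞 ℚ) = WithZero.exp (-1 : ℤ))
    (hCW : ∃ C : VariableChange ℚ, C • V.quadraticTwist (d : ℚ) = W)
    (C : AddSubgroup (V.geomPrimaryTorsion p))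
    (hCD : ∀ δ ∈ decomp v, ∀ c ∈ C, δ • c ∈ C)
    (hC1 : Set.ncard {c : V.geomPrimaryTorsion p | c ∈ C ∧ p • c = 0} ≤ p)
    (hCord : ∀ k : ℕ, ∃ c ∈ C, addOrderOf c = p ^ k)
    (htriv : ∀ x ∈ inertia v, ∀ m : V.geomPrimaryTorsion p, x • m - m ∈ C)
    (a : ℤ) (α : ℤ_[p]ˣ) (hα : ((α : ℤ_[p])) ^ 2 = a * (α : ℤ_[p]) - p)
    (hchar : ∀ (σ : absoluteGaloisGroup (v.adicCompletion ℚ)) (n : ℕ), IsFrobPow σ (n : ℤ) →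
      ∀ (k : ℕ) (c : V.geomPrimaryTorsion p), c ∈ C → p ^ k • c = 0 →
        ∀ N : ℤ, ((N : ℤ_[p]) -
            ((GaloisRep.cyclotomicCharacter ℚ p (absGaloisRestrict ℚ (v.adicCompletion ℚ) σ) *
              (α⁻¹) ^ n : ℤ_[p]ˣ) : ℤ_[p]) ∈ (Ideal.span {(p : ℤ_[p]) ^ k} : Ideal ℤ_[p])) →
          absGaloisRestrict ℚ (v.adicCompletion ℚ) σ • c = N • c) :
    ∃ (C' : AddSubgroup (W.geomPrimaryTorsion p)) (a' : ℤ) (α' : ℤ_[p]ˣ),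
      (∀ δ ∈ decomp v, ∀ c ∈ C', δ • c ∈ C') ∧
      Set.ncard {c : W.geomPrimaryTorsion p | c ∈ C' ∧ p • c = 0} ≤ p ∧
      (∀ k : ℕ, ∃ c ∈ C', addOrderOf c = p ^ k) ∧
      (∃ τ ∈ decomp v, ∀ m : W.geomPrimaryTorsion p, τ • m + m ∈ C') ∧
      ((α' : ℤ_[p])) ^ 2 = a' * (α' : ℤ_[p]) - p ∧
      (∀ (σ : absoluteGaloisGroup (v.adicCompletion ℚ)) (n : ℕ), IsFrobPow σ (n : ℤ) →
        ∃ s : ℤ, (s = 1 ∨ s = -1) ∧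
          ∀ (k : ℕ) (c : W.geomPrimaryTorsion p), c ∈ C' → p ^ k • c = 0 →
            ∀ N : ℤ, ((N : ℤ_[p]) - s *
                ((GaloisRep.cyclotomicCharacter ℚ p (absGaloisRestrict ℚ (v.adicCompletion ℚ) σ) *
                  (α'⁻¹) ^ n : ℤ_[p]ˣ) : ℤ_[p]) ∈ (Ideal.span {(p : ℤ_[p]) ^ k} : Ideal ℤ_[p])) →
              absGaloisRestrict ℚ (v.adicCompletion ℚ) σ • c = N • c) := by
  have hd0 : (d : ℚ) ≠ 0 := by
    intro h
    have hdz : (d : 𝓞 ℚ) = 0 := by exact_mod_cast (Int.cast_eq_zero.1 h)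
    rw [hdz, map_zero] at hd
    exact WithZero.zero_ne_coe hd
  haveI : NeZero (2 : ℚ) := ⟨two_ne_zero⟩
  obtain ⟨e, he, -, heneg⟩ :=
    Summit.BirchSwinnertonDyer.Rank1Residual.Additive.exists_addEquiv_geomPrimaryTorsion_of_model_twist_sign
      p V hd0 hCW
  exact lineCharacter_twist_rat hp2 hpv hd e he heneg C hCD hC1 hCord htriv a α hα hchar

end Rat

/-! ## §3. The (G-ord, `e = 2`) cell at `(ℚ, v)`: Greenberg's reduction line of the good-ordinary
`p*`-twist model, twisted — modulo FILE 1 (the unit-root character of `C_v(V)`) as an explicit hypothesis -/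

section CellG

open Literature.NumberTheory.EllipticCurves.Rank1Residual
  Summit.BirchSwinnertonDyer.Rank1Residual.Additive
  Summit.BirchSwinnertonDyer.Rank1Residual.X2.GreenbergVatsalReductionDatum

variable {p : ℕ} [hp : Fact p.Prime] {v : HeightOneSpectrum (𝓞 ℚ)}

/-- **The line WITH character of a good-ordinary `p*`-twist model, at `(ℚ, v)` — modulo FILE 1.**
`V/ℚ` globally minimal, GOOD ORDINARY at the odd `p` (`GoodOrd V p`), `W = C • V^{(p*)}`, `v ∋ p`.
Granted FILE 1's unit-root character of Greenberg's reduction line `C_v(V) = ker(V[p^∞] → Ṽ(k̄_v))`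
(hypothesis `hunit`: some `α ∈ ℤ_p^×`, `α² = aα − p`, such that every `σ ∈ Γ_{ℚ_v}` of Frobenius degree
`n` acts on `C_v(V)[p^k]` by `χ_p(res σ)·α^{−n}` — Greenberg LNM 1716 §2 p. 70, `φψ⁻¹ = χ` on the line,
`φ` unramified with `φ(Frob) =` the unit root; door-c6 g3's `…OrdinaryLineUnitRoot`), the twisted line
`t(C_v(V)) ⊂ W[p^∞]` is a line WITH character at `(ℚ, v)` in the shape of hypothesis (ii) of
`stub_finV_gordTwo_of_lineCharacter`: the other clauses are TREE THEOREMS — `D_v`-stability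
(X2 `reductionDatum`), divisible / proper / non-zero (FILE B `reductionDatum_divisible`,
`…_plus_ne_top`, `…_plus_ne_bot`) hence `#C[p] ≤ p` and all orders (`lineClauses_of_divisible`),
inertia trivial modulo `C_v` (`reductionDatum_htriv`), and the twist (§2, `d = p*`, `ord_v p* = 1`).
[cite: GreenbergLNM1716, §1 p. 62 and §2 pp. 69–70] [cite: EmertonPollackWeston2006, §3.1 (eq:ordes) (arXiv:math/0404484 p. 17)]
[cite: SilvermanAEC2009, X.5 Cor. 5.4] -/
theorem lineCharacter_rat_of_goodOrd_pStar_twist_of_unitRoot (hp2 : p ≠ 2)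
    (V : WeierstrassCurve ℚ) [V.IsElliptic] [V.IsGloballyMinimal] (hV : GoodOrd V p)
    (hpv : ((p : ℕ) : 𝓞 ℚ) ∈ v.asIdeal)
    (hunit : ∀ (hΔ : ¬ (p : ℤ) ∣ minimalDiscriminantInt V), ∃ (a : ℤ) (α : ℤ_[p]ˣ),
      ((α : ℤ_[p])) ^ 2 = a * (α : ℤ_[p]) - p ∧
      ∀ (σ : absoluteGaloisGroup (v.adicCompletion ℚ)) (n : ℕ), IsFrobPow σ (n : ℤ) →
        ∀ (k : ℕ) (c : V.geomPrimaryTorsion p), c ∈ (reductionDatum V p hpv hΔ).plus → p ^ k • c = 0 →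
          ∀ N : ℤ, ((N : ℤ_[p]) -
              ((GaloisRep.cyclotomicCharacter ℚ p (absGaloisRestrict ℚ (v.adicCompletion ℚ) σ) *
                (α⁻¹) ^ n : ℤ_[p]ˣ) : ℤ_[p]) ∈ (Ideal.span {(p : ℤ_[p]) ^ k} : Ideal ℤ_[p])) →
            absGaloisRestrict ℚ (v.adicCompletion ℚ) σ • c = N • c)
    {W : WeierstrassCurve ℚ} [W.IsElliptic]
    (hCW : ∃ C : VariableChange ℚ, C • V.quadraticTwist ((-1 : ℚ) ^ (p / 2) * p) = W) :
    ∃ (C' : AddSubgroup (W.geomPrimaryTorsion p)) (a' : ℤ) (α' : ℤ_[p]ˣ),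
      (∀ δ ∈ decomp v, ∀ c ∈ C', δ • c ∈ C') ∧
      Set.ncard {c : W.geomPrimaryTorsion p | c ∈ C' ∧ p • c = 0} ≤ p ∧
      (∀ k : ℕ, ∃ c ∈ C', addOrderOf c = p ^ k) ∧
      (∃ τ ∈ decomp v, ∀ m : W.geomPrimaryTorsion p, τ • m + m ∈ C') ∧
      ((α' : ℤ_[p])) ^ 2 = a' * (α' : ℤ_[p]) - p ∧
      (∀ (σ : absoluteGaloisGroup (v.adicCompletion ℚ)) (n : ℕ), IsFrobPow σ (n : ℤ) →
        ∃ s : ℤ, (s = 1 ∨ s = -1) ∧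
          ∀ (k : ℕ) (c : W.geomPrimaryTorsion p), c ∈ C' → p ^ k • c = 0 →
            ∀ N : ℤ, ((N : ℤ_[p]) - s *
                ((GaloisRep.cyclotomicCharacter ℚ p (absGaloisRestrict ℚ (v.adicCompletion ℚ) σ) *
                  (α'⁻¹) ^ n : ℤ_[p]ˣ) : ℤ_[p]) ∈ (Ideal.span {(p : ℤ_[p]) ^ k} : Ideal ℤ_[p])) →
              absGaloisRestrict ℚ (v.adicCompletion ℚ) σ • c = N • c) := by
  have hΔ : ¬ (p : ℤ) ∣ minimalDiscriminantInt V :=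
    V.not_dvd_minimalDiscriminantInt_of_hasGoodReductionAtPrime' p hV.1
  have hord : ¬ (p : ℤ) ∣ V.frobeniusTrace p := hV.2
  obtain ⟨a, α, hα, hchar⟩ := hunit hΔ
  set L := reductionDatum V p hpv hΔ with hL
  -- the tree clauses of Greenberg's reduction line
  have hdiv := reductionDatum_divisible V p hpv hΔ hord
  have htop := reductionDatum_plus_ne_top V p hpv hΔ hord
  have hbot := reductionDatum_plus_ne_bot V p hpv hΔ hord
  obtain ⟨hC1, hCord⟩ := V.lineClauses_of_divisible L.plus hdiv htop hbot
  have hCD : ∀ δ ∈ decomp v, ∀ c ∈ L.plus, δ • c ∈ L.plus := by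
    intro δ hδ c hc
    obtain ⟨σ, rfl⟩ := (mem_decomp_iff v δ).1 hδ
    exact L.smul_mem σ hc
  have htriv := reductionDatum_htriv V p hpv hΔ
  -- the twist by `d = p*`, `ord_v p* = 1`
  have hCW' : ∃ C : VariableChange ℚ,
      C • V.quadraticTwist ((((-1 : ℤ) ^ (p / 2) * p : ℤ)) : ℚ) = W := by
    push_cast
    exact hCW
  exact lineCharacter_model_twist_rat hp2 hpv (intValuation_pStar p hpv) hCW' L.plus hCD hC1 hCord
    htriv a α hα hchar

/-- **The (G-ord, `e = 2`) cell of X3 at `(ℚ, v)`, modulo FILE 1.** For `W/ℚ` globally minimal in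
X3 ∩ (G-ord, `e = 2`) at the odd `p` and the place `v ∋ p`: granted FILE 1's unit-root character for
EVERY globally minimal good-ordinary `V/ℚ` at `v`, there is a line WITH character on `W[p^∞]` at
`(ℚ, v)` (hypothesis-(ii) shape): the twist model is `ClassX3Gord.exists_goodOrd_pStar_twist_model`
(`classX3Gord_of_subGordTwo_of_odd`). This is the `(ℚ, v)`-level input of FILE 3 (door-c4 g5: transport to
`(K, 𝔭)` at a split `p`). [cite: GreenbergLNM1716, §2 pp. 69–70]
[cite: EmertonPollackWeston2006, §3.1 (eq:ordes) (arXiv:math/0404484 p. 17)] -/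
theorem lineCharacter_rat_of_subGordTwo_of_unitRoot (hp2 : p ≠ 2) (hpv : ((p : ℕ) : 𝓞 ℚ) ∈ v.asIdeal)
    (hunit : ∀ (V : WeierstrassCurve ℚ) [V.IsElliptic] [V.IsGloballyMinimal],
      GoodOrd V p → ∀ (hΔ : ¬ (p : ℤ) ∣ minimalDiscriminantInt V), ∃ (a : ℤ) (α : ℤ_[p]ˣ),
      ((α : ℤ_[p])) ^ 2 = a * (α : ℤ_[p]) - p ∧
      ∀ (σ : absoluteGaloisGroup (v.adicCompletion ℚ)) (n : ℕ), IsFrobPow σ (n : ℤ) →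
        ∀ (k : ℕ) (c : V.geomPrimaryTorsion p), c ∈ (reductionDatum V p hpv hΔ).plus → p ^ k • c = 0 →
          ∀ N : ℤ, ((N : ℤ_[p]) -
              ((GaloisRep.cyclotomicCharacter ℚ p (absGaloisRestrict ℚ (v.adicCompletion ℚ) σ) *
                (α⁻¹) ^ n : ℤ_[p]ˣ) : ℤ_[p]) ∈ (Ideal.span {(p : ℤ_[p]) ^ k} : Ideal ℤ_[p])) →
            absGaloisRestrict ℚ (v.adicCompletion ℚ) σ • c = N • c)
    (W : WeierstrassCurve ℚ) [W.IsElliptic] [W.IsGloballyMinimal] (hX : ClassX3 W p)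
    (hS : SubGordTwo W p) :
    ∃ (C' : AddSubgroup (W.geomPrimaryTorsion p)) (a' : ℤ) (α' : ℤ_[p]ˣ),
      (∀ δ ∈ decomp v, ∀ c ∈ C', δ • c ∈ C') ∧
      Set.ncard {c : W.geomPrimaryTorsion p | c ∈ C' ∧ p • c = 0} ≤ p ∧
      (∀ k : ℕ, ∃ c ∈ C', addOrderOf c = p ^ k) ∧
      (∃ τ ∈ decomp v, ∀ m : W.geomPrimaryTorsion p, τ • m + m ∈ C') ∧
      ((α' : ℤ_[p])) ^ 2 = a' * (α' : ℤ_[p]) - p ∧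
      (∀ (σ : absoluteGaloisGroup (v.adicCompletion ℚ)) (n : ℕ), IsFrobPow σ (n : ℤ) →
        ∃ s : ℤ, (s = 1 ∨ s = -1) ∧
          ∀ (k : ℕ) (c : W.geomPrimaryTorsion p), c ∈ C' → p ^ k • c = 0 →
            ∀ N : ℤ, ((N : ℤ_[p]) - s *
                ((GaloisRep.cyclotomicCharacter ℚ p (absGaloisRestrict ℚ (v.adicCompletion ℚ) σ) *
                  (α'⁻¹) ^ n : ℤ_[p]ˣ) : ℤ_[p]) ∈ (Ideal.span {(p : ℤ_[p]) ^ k} : Ideal ℤ_[p])) →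
              absGaloisRestrict ℚ (v.adicCompletion ℚ) σ • c = N • c) := by
  obtain ⟨V, _, _, C, hV, hC⟩ := ClassX3Gord.exists_goodOrd_pStar_twist_model W p hp2
    (classX3Gord_of_subGordTwo_of_odd W p hp2 hX hS) hS.2
  exact lineCharacter_rat_of_goodOrd_pStar_twist_of_unitRoot hp2 V hV hpv (hunit V hV) ⟨C, hC⟩

end CellG

end Summit.BirchSwinnertonDyer.BirchSwinnertonDyer.Theorems.SchneiderFreeAdditiveX3

end
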